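import Literature.NumberTheory.Automorphic.UnitaryInductionCompleteReducibility
import Literature.NumberTheory.Automorphic.SmoothIndCellFunCompactSupport
import Literature.RepresentationTheory.Semisimple.UnitarizableAdmissibleSemisimple
import HarnessLib

/-!
# Unitary parabolic induction on `GL_N(F)` is unitarizable — vector-valued inducing data (R90-TF S1#7 helper)

R90-TF · S1 «Ch10-local» · helper for S1#7 (`stub_S1_split_parabolicInd_irreducible_of_unitary`).  For a non-archimedean local field
`F`, a block labelling `c`, and a representation `τ` of the standard Levi `Π_a GL_{n_a}(F)` on `W` carrying a `τ`-invariant positive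
definite Hermitian form (`Representation.IsUnitarizable`), the normalised induced representation `i_c τ`
(`Representation.parabolicIndGL`) carries the invariant positive definite Hermitian form `⟪f₁, f₂⟫ = ∫_{K₀} B (f₁ k) (f₂ k) dμ_{K₀}`
(`K₀` compact open with `GL_N(F) = P_c K₀`): the vector-valued twin of ★ `isSemisimpleRepresentation_parabolicIndGL_twist`
[Cartier1979, Thm. 3.2 (c), (9)–(11) p. 136; BernsteinZelevinsky1977 §2.3].  If `τ` is moreover admissible, `i_c τ` is admissible
(★ `isAdmissible_parabolicIndGL_holds`) hence completely reducible (★ `IsUnitarizable.isSemisimpleRepresentation_of_isAdmissible`) — used in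
`Theorems/R90S1SplitInducedIrreducibleOfEndScalar` (S1#7, `stub_S1_split_parabolicInd_irreducible_of_unitary`).  Cell `hodgecm-mathlib`, programme R90-TF,
seat R90-C10-p01 (g0); `--supports stmt-HodgeConjecture-24833 --as helper`; ONE public theorem; no definition, no named fact, no `sorry`.
HONEST LABEL: HC_CM is proved only modulo the 7 printed citations (2 remaining named inputs: hLiu418 = stmt-HodgeConjecture-24832,
h413 = stmt-HodgeConjecture-24833) until rung 0 closes; count-neutral helper.

## References
* [Cartier1979] P. Cartier, *Representations of p-adic groups: a survey*, PSPM 33.1 (1979), §III.3.3, Thm. 3.2 (c), (9)–(11) p. 136.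
* [BernsteinZelevinsky1977] I. N. Bernstein, A. V. Zelevinsky, Ann. Sci. ÉNS 10 (1977), 1.7–1.9, §2.3.
* [GetzHahn2024] J. R. Getz, H. Hahn, GTM 300 (2024), Exercise 5.4 p. 111.
-/

set_option linter.dupNamespace false

noncomputable section

open MeasureTheory Measure Set Filter Topology
open scoped NNReal ENNReal ComplexConjugate

namespace Summit.HodgeConjecture.HodgeConjecture.R90.S1

open Literature.NumberTheory Literature.NumberTheory.Automorphic

section GLn

variable (F : Type*) [Field F] [ValuativeRel F] [TopologicalSpace F] [IsNonarchimedeanLocalField F]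

/-- `GL_N(F)` is Hausdorff. [folklore] -/
private theorem t2Space_gl (N : ℕ) : T2Space (GL (Fin N) F) := by
  haveI : T2Space F := (GaloisRepresentations.IsNonarchimedeanLocalField.isLocalField F).toT2Space
  infer_instance

/-- `GL_N(F)` is locally compact. [folklore] -/
private theorem locallyCompactSpace_gl (N : ℕ) : LocallyCompactSpace (GL (Fin N) F) := by
  haveI : T2Space F := (GaloisRepresentations.IsNonarchimedeanLocalField.isLocalField F).toT2Space
  haveI : LocallyCompactSpace (Matrix (Fin N) (Fin N) F) :=
    inferInstanceAs (LocallyCompactSpace (Fin N → Fin N → F))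
  haveI : LocallyCompactSpace (Matrix (Fin N) (Fin N) F)ᵐᵒᵖ :=
    MulOpposite.opHomeomorph.symm.isClosedEmbedding.locallyCompactSpace
  exact Units.isClosedEmbedding_embedProduct.locallyCompactSpace

/-- `GL_N(F)` is second countable. [folklore] -/
private theorem secondCountableTopology_gl (N : ℕ) : SecondCountableTopology (GL (Fin N) F) := by
  haveI := secondCountableTopology_localField F
  haveI : SecondCountableTopology (Matrix (Fin N) (Fin N) F) :=
    inferInstanceAs (SecondCountableTopology (Fin N → Fin N → F))
  haveI : SecondCountableTopology (Matrix (Fin N) (Fin N) F)ᵐᵒᵖ :=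
    MulOpposite.opHomeomorph.symm.secondCountableTopology
  exact Units.isEmbedding_embedProduct.secondCountableTopology

variable {N : ℕ} {α : Type*} [LinearOrder α] [Fintype α] (c : Fin N → α)
  [LocallyCompactSpace (standardParabolicGL F c)]
  {W : Type*} [AddCommGroup W] [Module ℂ W]

omit [Fintype α] in
/-- **`B (f₁ (p x)) (f₂ (p x)) = Δ_{P_c}(p) · B (f₁ x) (f₂ x)`** for `f₁, f₂ ∈ i_c τ` and a `τ`-invariant sesquilinear `B`:
`f (p x) = δ^{1/2}(p) • τ(proj p) (f x)`, `(δ^{1/2})² = Δ_{P_c}`. [cite: Cartier1979, Thm. 3.2 (c) and (11), p. 136] -/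
private theorem sesq_toFun_parabolicIndGL_mul (τ : Representation ℂ (Π a, GL {i // c i = a} F) W)
    (B : W →ₗ⋆[ℂ] W →ₗ[ℂ] ℂ) (hB : ∀ (m : Π a, GL {i // c i = a} F) (v w : W), B (τ m v) (τ m w) = B v w)
    (f₁ f₂ : Representation.SmoothInd (standardParabolicGL F c)
      (Representation.twist (τ.comp (leviProjection F c)) (rootDeltaChar (standardParabolicGL F c))))
    (p : standardParabolicGL F c) (x : GL (Fin N) F) :
    B (f₁.toFun ((p : GL (Fin N) F) * x)) (f₂.toFun ((p : GL (Fin N) F) * x)) =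
      ((modularCharacter p : ℝ≥0) : ℂ) * B (f₁.toFun x) (f₂.toFun x) := by
  rw [Representation.SmoothInd.toFun_subgroup_mul, Representation.SmoothInd.toFun_subgroup_mul,
    Representation.twist_apply, Representation.twist_apply, LinearMap.map_smulₛₗ₂, LinearMap.map_smul,
    MonoidHom.coe_comp, Function.comp_apply, hB, rootDeltaChar_apply]
  set r : ℝ := ((NNReal.sqrt (modularCharacter p) : ℝ≥0) : ℝ) with hr
  have hrr : (r : ℂ) * (r : ℂ) = ((modularCharacter p : ℝ≥0) : ℝ) := by
    rw [← Complex.ofReal_mul, hr, ← NNReal.coe_mul, NNReal.mul_self_sqrt]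
  rw [smul_eq_mul, smul_eq_mul, starRingEnd_apply, Complex.star_def, Complex.conj_ofReal, ← mul_assoc, hrr]

omit [Fintype α] in
/-- **Unitary parabolic induction is unitarizable (vector-valued inducing data).**  For `τ` unitarizable on `W`, the normalised
induced representation `i_c τ` of `GL_N(F)` carries the invariant positive definite Hermitian form
`⟪f₁, f₂⟫ = ∫_{K₀} B (f₁ k) (f₂ k) dμ_{K₀}` (`GL_N(F) = P_c K₀`, `K₀` compact open; invariance by ★ `integral_subgroup_comp_mul_right_eq` applied to
`x ↦ B (f₁ x) (f₂ x) ∈ Ind(Δ_{P_c})`). [cite: Cartier1979, Thm. 3.2 (c) with (9)–(11), p. 136] [cite: BernsteinZelevinsky1977, §2.3] -/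
theorem isUnitarizable_parabolicIndGL_of_isUnitarizable (τ : Representation ℂ (Π a, GL {i // c i = a} F) W)
    (hτ : τ.IsUnitarizable) : (Representation.parabolicIndGL F c τ).IsUnitarizable := by
  classical
  obtain ⟨B, hBs, hBp, hBinv⟩ := hτ
  haveI : T2Space (GL (Fin N) F) := t2Space_gl F N
  haveI : LocallyCompactSpace (GL (Fin N) F) := locallyCompactSpace_gl F N
  haveI : SecondCountableTopology (GL (Fin N) F) := secondCountableTopology_gl F N
  letI : MeasurableSpace (GL (Fin N) F) := borel _
  haveI : BorelSpace (GL (Fin N) F) := ⟨rfl⟩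
  have hPc : IsClosed (standardParabolicGL F c : Set (GL (Fin N) F)) := isClosed_standardParabolicGL F c
  obtain ⟨K₀, hK₀c, hK₀o, hPK₀⟩ := exists_isCompact_isOpen_forall_standardParabolicGL_mul F c
  haveI : CompactSpace K₀ := isCompact_iff_compactSpace.1 hK₀c
  set μG : Measure (GL (Fin N) F) := Measure.haar with hμG
  set μK : Measure K₀ := Measure.haar with hμK
  haveI : μG.IsMulRightInvariant := GLn.isMulRightInvariant_of_isHaarMeasure_local N F μG
  -- the integrand `k ↦ B (f₁ k) (f₂ k)` is locally constant, hence continuous and integrable on `K₀`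
  have hlc : ∀ f₁ f₂ : Representation.SmoothInd (standardParabolicGL F c)
      (Representation.twist (τ.comp (leviProjection F c)) (rootDeltaChar (standardParabolicGL F c))),
      IsLocallyConstant fun x : GL (Fin N) F => B (f₁.toFun x) (f₂.toFun x) := by
    intro f₁ f₂
    have h1 := Representation.SmoothInd.isLocallyConstant_toFun f₁
    have h2 := Representation.SmoothInd.isLocallyConstant_toFun f₂
    exact (h1.prodMk h2).comp (fun vw : W × W => B vw.1 vw.2)
  have hcont : ∀ f₁ f₂ : Representation.SmoothInd (standardParabolicGL F c)
      (Representation.twist (τ.comp (leviProjection F c)) (rootDeltaChar (standardParabolicGL F c))),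
      Continuous fun x : GL (Fin N) F => B (f₁.toFun x) (f₂.toFun x) :=
    fun f₁ f₂ => (hlc f₁ f₂).continuous
  have hint : ∀ f₁ f₂ : Representation.SmoothInd (standardParabolicGL F c)
      (Representation.twist (τ.comp (leviProjection F c)) (rootDeltaChar (standardParabolicGL F c))),
      Integrable (fun k : K₀ => B (f₁.toFun k) (f₂.toFun k)) μK := by
    intro f₁ f₂
    exact ((hcont f₁ f₂).comp continuous_subtype_val).integrable_of_hasCompactSupport
      (HasCompactSupport.of_compactSpace _)
  -- the form
  let ip : Representation.SmoothInd (standardParabolicGL F c)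
      (Representation.twist (τ.comp (leviProjection F c)) (rootDeltaChar (standardParabolicGL F c))) → Representation.SmoothInd (standardParabolicGL F c)
      (Representation.twist (τ.comp (leviProjection F c)) (rootDeltaChar (standardParabolicGL F c))) → ℂ :=
    fun f₁ f₂ => ∫ k : K₀, B (f₁.toFun k) (f₂.toFun k) ∂μK
  have ip_add_left : ∀ f₁ f₂ f₃, ip (f₁ + f₂) f₃ = ip f₁ f₃ + ip f₂ f₃ := by
    intro f₁ f₂ f₃
    show ∫ k : K₀, B ((f₁ + f₂).toFun k) (f₃.toFun k) ∂μK =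
      (∫ k : K₀, B (f₁.toFun k) (f₃.toFun k) ∂μK) + ∫ k : K₀, B (f₂.toFun k) (f₃.toFun k) ∂μK
    rw [← integral_add (hint f₁ f₃) (hint f₂ f₃)]
    refine integral_congr_ae (Eventually.of_forall fun k => ?_)
    simp only [Representation.SmoothInd.toFun_add, Pi.add_apply, map_add, LinearMap.add_apply]
  have ip_smul_left : ∀ (r : ℂ) f₁ f₂, ip (r • f₁) f₂ = conj r * ip f₁ f₂ := by
    intro r f₁ f₂
    show ∫ k : K₀, B ((r • f₁).toFun k) (f₂.toFun k) ∂μK = conj r * ∫ k : K₀, B (f₁.toFun k) (f₂.toFun k) ∂μK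
    rw [← integral_const_mul]
    refine integral_congr_ae (Eventually.of_forall fun k => ?_)
    simp only [Representation.SmoothInd.toFun_smul, Pi.smul_apply, LinearMap.map_smulₛₗ₂, smul_eq_mul]
  have ip_add_right : ∀ f₁ f₂ f₃, ip f₁ (f₂ + f₃) = ip f₁ f₂ + ip f₁ f₃ := by
    intro f₁ f₂ f₃
    show ∫ k : K₀, B (f₁.toFun k) ((f₂ + f₃).toFun k) ∂μK =
      (∫ k : K₀, B (f₁.toFun k) (f₂.toFun k) ∂μK) + ∫ k : K₀, B (f₁.toFun k) (f₃.toFun k) ∂μK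
    rw [← integral_add (hint f₁ f₂) (hint f₁ f₃)]
    refine integral_congr_ae (Eventually.of_forall fun k => ?_)
    simp only [Representation.SmoothInd.toFun_add, Pi.add_apply, map_add]
  have ip_smul_right : ∀ (r : ℂ) f₁ f₂, ip f₁ (r • f₂) = r * ip f₁ f₂ := by
    intro r f₁ f₂
    show ∫ k : K₀, B (f₁.toFun k) ((r • f₂).toFun k) ∂μK = r * ∫ k : K₀, B (f₁.toFun k) (f₂.toFun k) ∂μK
    rw [← integral_const_mul]
    refine integral_congr_ae (Eventually.of_forall fun k => ?_)
    simp only [Representation.SmoothInd.toFun_smul, Pi.smul_apply, map_smul, smul_eq_mul]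
  let Bi : Representation.SmoothInd (standardParabolicGL F c)
      (Representation.twist (τ.comp (leviProjection F c)) (rootDeltaChar (standardParabolicGL F c))) →ₗ⋆[ℂ] Representation.SmoothInd (standardParabolicGL F c)
      (Representation.twist (τ.comp (leviProjection F c)) (rootDeltaChar (standardParabolicGL F c))) →ₗ[ℂ] ℂ :=
    LinearMap.mk₂'ₛₗ (starRingEnd ℂ) (RingHom.id ℂ) ip ip_add_left
      (fun r f₁ f₂ => by rw [ip_smul_left, smul_eq_mul, starRingEnd_apply, Complex.star_def]) ip_add_right
      (fun r f₁ f₂ => by rw [ip_smul_right, RingHom.id_apply, smul_eq_mul])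
  have hBi : ∀ f₁ f₂, Bi f₁ f₂ = ∫ k : K₀, B (f₁.toFun k) (f₂.toFun k) ∂μK := fun _ _ => rfl
  -- pointwise facts about `B v v`
  have hre : ∀ v : W, 0 ≤ (B v v).re := by
    intro v
    by_cases hv : v = 0
    · subst hv; simp
    · exact (hBp v hv).le
  have hself : ∀ v : W, B v v = ((B v v).re : ℂ) := by
    intro v
    have h := hBs.eq v v
    rw [starRingEnd_apply, Complex.star_def] at h
    exact (Complex.conj_eq_iff_re.1 h).symm
  refine ⟨Bi, ⟨fun f₁ f₂ => ?_⟩, fun f hf => ?_, fun g f₁ f₂ => ?_⟩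
  · -- Hermitian symmetry
    rw [hBi, hBi, starRingEnd_apply, Complex.star_def, ← integral_conj]
    refine integral_congr_ae (Eventually.of_forall fun k => ?_)
    have h := hBs.eq (f₁.toFun k) (f₂.toFun k)
    rw [starRingEnd_apply, Complex.star_def] at h
    exact h
  · -- positive definiteness
    rw [hBi]
    have hreal : (∫ k : K₀, B (f.toFun k) (f.toFun k) ∂μK) =
        ((∫ k : K₀, (B (f.toFun k) (f.toFun k)).re ∂μK : ℝ) : ℂ) := by
      rw [← integral_complex_ofReal]
      exact integral_congr_ae (Eventually.of_forall fun k => hself (f.toFun k))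
    rw [hreal, Complex.ofReal_re]
    have hc2 : Continuous fun k : K₀ => (B (f.toFun k) (f.toFun k)).re :=
      Complex.continuous_re.comp ((hcont f f).comp continuous_subtype_val)
    have hnn : 0 ≤ fun k : K₀ => (B (f.toFun k) (f.toFun k)).re := fun k => hre _
    have hintR : Integrable (fun k : K₀ => (B (f.toFun k) (f.toFun k)).re) μK :=
      hc2.integrable_of_hasCompactSupport (HasCompactSupport.of_compactSpace _)
    rcases (integral_nonneg hnn).lt_or_eq with hlt | heq
    · exact hlt
    · exfalso
      apply hf
      have hae := (integral_eq_zero_iff_of_nonneg hnn hintR).1 heq.symm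
      have hzero : ∀ k : K₀, f.toFun k = 0 := by
        have hfun : (fun k : K₀ => (B (f.toFun k) (f.toFun k)).re) = fun _ => (0 : ℝ) :=
          (Continuous.ae_eq_iff_eq μK hc2 continuous_const).1 hae
        intro k
        have hk := congrFun hfun k
        by_contra hne
        exact (lt_irrefl (0 : ℝ)) (lt_of_lt_of_eq (hBp _ hne) hk)
      apply Representation.SmoothInd.ext
      funext x
      obtain ⟨p, hp, k, hk, rfl⟩ := hPK₀ x
      rw [Representation.SmoothInd.toFun_zero, Pi.zero_apply,
        show p * k = ((⟨p, hp⟩ : standardParabolicGL F c) : GL (Fin N) F) * k from rfl,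
        Representation.SmoothInd.toFun_subgroup_mul, hzero ⟨k, hk⟩, map_zero]
  · -- invariance
    rw [hBi, hBi]
    have h := integral_subgroup_comp_mul_right_eq (H := standardParabolicGL F c) (K := K₀) hPc hK₀o hK₀c hPK₀ μG μK
      (fun x => B (f₁.toFun x) (f₂.toFun x)) (hcont f₁ f₂)
      (fun p x => sesq_toFun_parabolicIndGL_mul F c τ B hBinv f₁ f₂ p x) g
    simpa [Representation.parabolicIndGL, Representation.toFun_smoothIndRep_apply] using h

end GLn

end Summit.HodgeConjecture.HodgeConjecture.R90.S1

end
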